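import Literature.Computability.AlgebraicComplexity.CircuitGateSemantics
import Summits.ValiantsHypothesis.ValiantsHypothesis.Theorems.DepthWindowHomBlocks
import Summits.ValiantsHypothesis.ValiantsHypothesis.Theorems.DepthWindowHomComponents
import Mathlib.RingTheory.MvPolynomial.WeightedHomogeneous
import HarnessLib

/-!
# Strassen's component-wise expansion in the gate-list model: the constructions

For route `DepthWindow` / crux `HomSubReach` (`HomRel` family).  Given component operands
`out₀ j e` for the gates `j < n` of an already treated prefix, `cop u e` is the operand computing
the weight-`e` component of the value of an operand `u`; `sumBlock` replaces a sum gate by `d + 1`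
sum gates (one per component `e ≤ d`); `prodP e` / `prodS` replace a product gate `∏_{l<t} u_l`
by one product gate `∏_l (u_l)_{f l}` per weak composition `f` of `e` into `t` parts and one
collecting sum gate, iterated over `e = 0, …, d` by `prodBlocks`.  This file proves the value,
depth and size lemmas of one step; the invariant and the theorem are in `DepthWindowHomFanIn`.

[cite: Strassen1973, §3] [cite: Raz2013, §2] [cite: LimayeSrinivasanTavenas2025, Lemma 11, Lemma 19]
[cite: Burgisser2000, Def. 2.1]
-/

set_option linter.dupNamespace false

namespace Summit.ValiantsHypothesis.ValiantsHypothesis.Theorems.DepthWindow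

open MvPolynomial Literature.Computability.AlgebraicComplexity ArithCircuit
open Literature.Computability.AlgebraicComplexity.DepthReduction

variable {k : Type*} [CommSemiring k] {τ : Type*}

/-! ### The component operand -/

/-- The operand computing the weight-`e` component of the value of operand `u` of the OLD block,
given component operands `out₀ j e` for the old gates `j < n`: a variable `X t` is its own
weight-`w t` component, a constant its own weight-`0` component, everything else is `0`.
[cite: Strassen1973, §3] -/
def cop (w : τ → ℕ) (n : ℕ) (out₀ : ℕ → ℕ → Operand k τ) : Operand k τ → ℕ → Operand k τ
  | .var t, e => if w t = e then .var t else .const 0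
  | .const c, e => if e = 0 then .const c else .const 0
  | .gate j, e => if j < n then out₀ j e else .const 0

section Cop

variable (w : τ → ℕ) (n d L : ℕ) (out₀ : ℕ → ℕ → Operand k τ)
  (V₀ vals : List (MvPolynomial τ k)) (D₀ ds : List ℕ)

/-- `cop` references only the prefix the old component operands reference. -/
theorem cop_refsBelow (hout : ∀ j e, j < n → e ≤ d → (out₀ j e).RefsBelow L) :
    ∀ (u : Operand k τ) (e : ℕ), e ≤ d → (cop w n out₀ u e).RefsBelow L
  | .var t, e, _ => by simp only [cop]; split_ifs <;> trivial
  | .const c, e, _ => by simp only [cop]; split_ifs <;> trivial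
  | .gate j, e, he => by
      simp only [cop]; split_ifs with h
      · exact hout j e h he
      · trivial

/-- `cop u e` evaluates to the weight-`e` component of the value of `u`.
[cite: Strassen1973, §3] -/
theorem eval_cop (hvals : vals.length = n)
    (hout : ∀ j e, j < n → e ≤ d →
      (out₀ j e).eval V₀ = weightedHomogeneousComponent w e (vals.getD j 0)) :
    ∀ (u : Operand k τ) (e : ℕ), e ≤ d →
      (cop w n out₀ u e).eval V₀ = weightedHomogeneousComponent w e (u.eval vals)
  | .var t, e, _ => by
      classical
      simp only [cop]
      rw [show (Operand.var t : Operand k τ).eval vals = X t from rfl,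
        weightedHomogeneousComponent_of_mem (isWeightedHomogeneous_X k w t)]
      by_cases h : w t = e
      · rw [if_pos h, if_pos h.symm]; rfl
      · rw [if_neg h, if_neg (fun h' => h h'.symm)]
        show C (0 : k) = 0
        exact C_0
  | .const c, e, _ => by
      classical
      simp only [cop]
      rw [show (Operand.const c : Operand k τ).eval vals = C c from rfl,
        weightedHomogeneousComponent_of_mem (isWeightedHomogeneous_C w c)]
      by_cases h : e = 0
      · rw [if_pos h, if_pos h]; rfl
      · rw [if_neg h, if_neg h]
        show C (0 : k) = 0
        exact C_0
  | .gate j, e, he => by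
      simp only [cop]
      by_cases h : j < n
      · rw [if_pos h, hout j e h he]; rfl
      · rw [if_neg h, Operand.eval_gate, List.getD_eq_default _ _ (by omega), map_zero]
        show C (0 : k) = 0
        exact C_0

/-- The depth of `cop u e` against the new depth list is at most the depth of `u` against the
old one. -/
theorem depthIn_cop (hout : ∀ j e, j < n → e ≤ d → (out₀ j e).depthIn D₀ ≤ ds.getD j 0) :
    ∀ (u : Operand k τ) (e : ℕ), e ≤ d → (cop w n out₀ u e).depthIn D₀ ≤ u.depthIn ds
  | .var t, e, _ => by simp only [cop]; split_ifs <;> exact Nat.zero_le _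
  | .const c, e, _ => by simp only [cop]; split_ifs <;> exact Nat.zero_le _
  | .gate j, e, he => by
      simp only [cop]
      split_ifs with h
      · exact hout j e h he
      · exact Nat.zero_le _

end Cop

/-! ### One step: the new gates for a SUM gate -/

section SumStep

variable (w : τ → ℕ) (n d : ℕ) (out₀ : ℕ → ℕ → Operand k τ) (args : List (k × Operand k τ))

/-- The `d + 1` sum gates computing the components of a sum gate. [cite: Strassen1973, §3] -/
def sumBlock : List (Gate k τ) :=
  (List.range (d + 1)).map fun e => Gate.sum (args.map fun a => (a.1, cop w n out₀ a.2 e))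

/-- The sum block has `d + 1` gates. -/
theorem length_sumBlock : (sumBlock w n d out₀ args).length = d + 1 := by
  simp [sumBlock]

/-- The sum block references the prefix only. -/
theorem sumBlock_argsBelow {L : ℕ} (hout : ∀ j e, j < n → e ≤ d → (out₀ j e).RefsBelow L) :
    ∀ G ∈ sumBlock w n d out₀ args, ∀ u ∈ G.args, u.RefsBelow L := by
  intro G hG u hu
  simp only [sumBlock, List.mem_map, List.mem_range] at hG
  obtain ⟨e, he, rfl⟩ := hG
  simp only [Gate.args, List.map_map, List.mem_map, Function.comp_apply] at hu
  obtain ⟨a, _, rfl⟩ := hu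
  exact cop_refsBelow w n d L out₀ hout a.2 e (by omega)

/-- The value of the `e`-th gate of the sum block is the weight-`e` component of the sum gate's
value. [cite: Strassen1973, §3] -/
theorem eval_sumBlock_gate (V₀ vals : List (MvPolynomial τ k)) (hvals : vals.length = n)
    (hout : ∀ j e, j < n → e ≤ d →
      (out₀ j e).eval V₀ = weightedHomogeneousComponent w e (vals.getD j 0))
    {e : ℕ} (he : e ≤ d) :
    (Gate.sum (args.map fun a => (a.1, cop w n out₀ a.2 e))).eval V₀ =
      weightedHomogeneousComponent w e ((Gate.sum args).eval vals) := by
  simp only [Gate.eval, List.map_map]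
  rw [map_list_sum, List.map_map]
  congr 1
  refine List.map_congr_left fun a _ => ?_
  simp only [Function.comp_apply, map_smul]
  rw [eval_cop w n d out₀ V₀ vals hvals hout a.2 e he]

/-- The depth of each gate of the sum block is at most the sum gate's depth entry. -/
theorem depthAgainst_sumBlock_le (D₀ ds : List ℕ)
    (hout : ∀ j e, j < n → e ≤ d → (out₀ j e).depthIn D₀ ≤ ds.getD j 0) {e : ℕ} (he : e ≤ d) :
    Gate.depthAgainst prodWeight D₀ (Gate.sum (args.map fun a => (a.1, cop w n out₀ a.2 e))) ≤
      Gate.depthAgainst prodWeight ds (Gate.sum args) := by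
  unfold Gate.depthAgainst
  have h0 : ∀ l : List (k × Operand k τ), prodWeight (Gate.sum l) = 0 := fun l => rfl
  rw [h0, h0, zero_add, zero_add]
  refine foldr_max_le fun x hx => ?_
  simp only [Gate.args, List.map_map, List.mem_map, Function.comp_apply] at hx
  obtain ⟨a, ha, rfl⟩ := hx
  refine (depthIn_cop w n d out₀ D₀ ds hout a.2 e he).trans ?_
  exact le_foldr_max_of_mem (by
    simp only [Gate.args, List.map_map, List.mem_map, Function.comp_apply]
    exact ⟨a, ha, rfl⟩)

end SumStep
/-! ### One step: the new gates for a PRODUCT gate (Strassen's expansion, per component) -/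

section ProdStep

variable (w : τ → ℕ) (n d : ℕ) (out₀ : ℕ → ℕ → Operand k τ) (us : List (Operand k τ))

/-- The product gates for component `e`: one per weak composition `f` of `e` into `fanIn` parts,
multiplying the `f l`-components of the operands. [cite: Strassen1973, §3] -/
def prodP (e : ℕ) : List (Gate k τ) :=
  (List.Nat.antidiagonalTuple us.length e).map fun f =>
    Gate.prod (List.ofFn fun l : Fin us.length => cop w n out₀ (us.get l) (f l))

/-- The sum gate collecting the product gates of component `e`, placed from position `L`.
[cite: Strassen1973, §3] -/
def prodS (L e : ℕ) : Gate k τ :=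
  Gate.sum ((List.range (prodP w n out₀ us e).length).map
    fun idx => ((1 : k), Operand.gate (L + idx)))

/-- The gate list after treating components `0, …, m-1` of the product gate, starting from `Ψ₀`.
[cite: Strassen1973, §3] -/
def prodBlocks (Ψ₀ : List (Gate k τ)) : ℕ → List (Gate k τ)
  | 0 => Ψ₀
  | m + 1 => prodBlocks Ψ₀ m ++
      (prodP w n out₀ us m ++ [prodS w n out₀ us (prodBlocks Ψ₀ m).length m])

/-- Index of the collecting gate of component `e`. -/
def prodOut (Ψ₀ : List (Gate k τ)) (e : ℕ) : ℕ :=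
  (prodBlocks w n out₀ us Ψ₀ e).length + (prodP w n out₀ us e).length

/-- Unfolding of `prodBlocks` at a successor. -/
theorem prodBlocks_succ (Ψ₀ : List (Gate k τ)) (m : ℕ) :
    prodBlocks w n out₀ us Ψ₀ (m + 1) = prodBlocks w n out₀ us Ψ₀ m ++
      (prodP w n out₀ us m ++ [prodS w n out₀ us (prodBlocks w n out₀ us Ψ₀ m).length m]) := rfl

/-- `prodBlocks` extends the starting list `Ψ₀`. -/
theorem prodBlocks_prefix (Ψ₀ : List (Gate k τ)) :
    ∀ m : ℕ, ∃ Y : List (Gate k τ), prodBlocks w n out₀ us Ψ₀ m = Ψ₀ ++ Y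
  | 0 => ⟨[], by simp [prodBlocks]⟩
  | m + 1 => by
      obtain ⟨Y, hY⟩ := prodBlocks_prefix Ψ₀ m
      exact ⟨Y ++ (prodP w n out₀ us m ++ [prodS w n out₀ us (prodBlocks w n out₀ us Ψ₀ m).length m]),
        by rw [prodBlocks_succ, hY, List.append_assoc]⟩

/-- `prodBlocks` is monotone: later stages extend earlier ones. -/
theorem prodBlocks_mono (Ψ₀ : List (Gate k τ)) (m : ℕ) :
    ∀ j : ℕ, ∃ Y : List (Gate k τ), prodBlocks w n out₀ us Ψ₀ (m + j) = prodBlocks w n out₀ us Ψ₀ m ++ Y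
  | 0 => ⟨[], by simp⟩
  | j + 1 => by
      obtain ⟨Y, hY⟩ := prodBlocks_mono Ψ₀ m j
      refine ⟨Y ++ (prodP w n out₀ us (m + j) ++
        [prodS w n out₀ us (prodBlocks w n out₀ us Ψ₀ (m + j)).length (m + j)]), ?_⟩
      rw [← Nat.add_assoc, prodBlocks_succ, hY, List.append_assoc]

variable {w n d out₀ us}

/-- Each part of a weak composition of `e` is at most `e`. -/
theorem le_of_mem_antidiagonalTuple {t e : ℕ} {f : Fin t → ℕ}
    (hf : f ∈ List.Nat.antidiagonalTuple t e) (l : Fin t) : f l ≤ e := by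
  rw [← List.Nat.mem_antidiagonalTuple.mp hf]
  exact Finset.single_le_sum (fun i _ => Nat.zero_le (f i)) (Finset.mem_univ l)

/-- The number of product gates for one component is at most `(F + 1) ^ d` when the fan-in is `≤ F`. [cite: Raz2013, §2] -/
theorem length_prodP_le {F : ℕ} (hF : us.length ≤ F) {e : ℕ} (he : e ≤ d) :
    (prodP w n out₀ us e).length ≤ (F + 1) ^ d := by
  rw [prodP, List.length_map]
  refine (length_antidiagonalTuple_le us.length e).trans ?_
  exact (Nat.pow_le_pow_left (by omega) e).trans (Nat.pow_le_pow_right (Nat.succ_pos F) he)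

/-- Size of the product construction after `m ≤ d + 1` components: `≤ |Ψ₀| + m · ((F + 1) ^ d + 1)`. [cite: Raz2013, §2] -/
theorem length_prodBlocks_le {F : ℕ} (hF : us.length ≤ F) (Ψ₀ : List (Gate k τ)) :
    ∀ m : ℕ, m ≤ d + 1 →
      (prodBlocks w n out₀ us Ψ₀ m).length ≤ Ψ₀.length + m * ((F + 1) ^ d + 1)
  | 0, _ => by simp [prodBlocks]
  | m + 1, hm => by
      rw [prodBlocks_succ, List.length_append, List.length_append, List.length_singleton]
      have h1 := length_prodBlocks_le hF Ψ₀ m (by omega)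
      have h2 : (prodP w n out₀ us m).length ≤ (F + 1) ^ d :=
        length_prodP_le (d := d) hF (by omega)
      calc (prodBlocks w n out₀ us Ψ₀ m).length + ((prodP w n out₀ us m).length + 1)
          ≤ Ψ₀.length + m * ((F + 1) ^ d + 1) + ((F + 1) ^ d + 1) := by omega
        _ = Ψ₀.length + (m + 1) * ((F + 1) ^ d + 1) := by ring

/-- The product gates reference the prefix only. -/
theorem prodP_argsBelow {L : ℕ} (hout : ∀ j e, j < n → e ≤ d → (out₀ j e).RefsBelow L)
    {e : ℕ} (he : e ≤ d) :
    ∀ G ∈ prodP w n out₀ us e, ∀ u ∈ G.args, u.RefsBelow L := by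
  intro G hG u hu
  simp only [prodP, List.mem_map] at hG
  obtain ⟨f, hf, rfl⟩ := hG
  simp only [Gate.args, List.mem_ofFn] at hu
  obtain ⟨l, rfl⟩ := hu
  exact cop_refsBelow w n d L out₀ hout (us.get l) (f l)
    ((le_of_mem_antidiagonalTuple hf l).trans he)

/-- Value of a product gate of the block, against any extension of the prefix values.
[cite: Strassen1973, §3] -/
theorem eval_prodP_gate (V₀ X vals : List (MvPolynomial τ k)) (hvals : vals.length = n)
    (hrefs : ∀ j e, j < n → e ≤ d → (out₀ j e).RefsBelow V₀.length)
    (hout : ∀ j e, j < n → e ≤ d →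
      (out₀ j e).eval V₀ = weightedHomogeneousComponent w e (vals.getD j 0))
    {e : ℕ} (he : e ≤ d) {f : Fin us.length → ℕ} (hf : f ∈ List.Nat.antidiagonalTuple us.length e) :
    (Gate.prod (List.ofFn fun l : Fin us.length => cop w n out₀ (us.get l) (f l))).eval (V₀ ++ X) =
      ∏ l : Fin us.length, weightedHomogeneousComponent w (f l) ((us.get l).eval vals) := by
  rw [gate_eval_append_of_refsBelow V₀ X (by
    intro u hu
    simp only [Gate.args, List.mem_ofFn] at hu
    obtain ⟨l, rfl⟩ := hu
    exact cop_refsBelow w n d V₀.length out₀ hrefs (us.get l) (f l)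
      ((le_of_mem_antidiagonalTuple hf l).trans he))]
  simp only [Gate.eval, List.map_ofFn, List.prod_ofFn, Function.comp_apply]
  exact Finset.prod_congr rfl fun l _ =>
    eval_cop w n d out₀ V₀ vals hvals hout (us.get l) (f l) ((le_of_mem_antidiagonalTuple hf l).trans he)

/-- The values of the product gates of component `e` sum to the weight-`e` component of the
product gate's value (Strassen's expansion). [cite: Strassen1973, §3] -/
theorem sum_map_eval_prodP (V₀ X vals : List (MvPolynomial τ k)) (hvals : vals.length = n)
    (hrefs : ∀ j e, j < n → e ≤ d → (out₀ j e).RefsBelow V₀.length)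
    (hout : ∀ j e, j < n → e ≤ d →
      (out₀ j e).eval V₀ = weightedHomogeneousComponent w e (vals.getD j 0))
    {e : ℕ} (he : e ≤ d) :
    ((prodP w n out₀ us e).map fun G => G.eval (V₀ ++ X)).sum =
      weightedHomogeneousComponent w e ((Gate.prod us).eval vals) := by
  have hv : (Gate.prod us).eval vals = ∏ l : Fin us.length, (us.get l).eval vals := by
    simp only [Gate.eval]; exact prod_map_eq_prod_get us _
  rw [hv, weightedHomogeneousComponent_prod_univ w us.length e, prodP, List.map_map]
  congr 1
  exact List.map_congr_left fun f hf => eval_prodP_gate V₀ X vals hvals hrefs hout he hf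

/-- Value of the collecting sum gate: the sum of the values placed right after position
`V.length`. -/
theorem eval_prodS (V Pv : List (MvPolynomial τ k)) {e L : ℕ} (hL : L = V.length)
    (hlen : Pv.length = (prodP w n out₀ us e).length) :
    (prodS w n out₀ us L e).eval (V ++ Pv) = Pv.sum := by
  subst hL
  simp only [prodS, Gate.eval, List.map_map, Function.comp_def, Operand.eval_gate,
    getD_append_length_add, one_smul]
  rw [← hlen]
  exact congrArg List.sum (map_getD_range 0 Pv)

/-- Depth entry of a product gate of the block is at most the product gate's entry. -/
theorem depthAgainst_prodP_le (D₀ X ds : List ℕ)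
    (hrefs : ∀ j e, j < n → e ≤ d → (out₀ j e).RefsBelow D₀.length)
    (hdp : ∀ j e, j < n → e ≤ d → (out₀ j e).depthIn D₀ ≤ ds.getD j 0)
    {e : ℕ} (he : e ≤ d) :
    ∀ G ∈ prodP w n out₀ us e,
      Gate.depthAgainst prodWeight (D₀ ++ X) G ≤ Gate.depthAgainst prodWeight ds (Gate.prod us) := by
  intro G hG
  rw [Gate.depthAgainst_append_of_argsBelow prodWeight D₀ X (prodP_argsBelow hrefs he G hG)]
  simp only [prodP, List.mem_map] at hG
  obtain ⟨f, hf, rfl⟩ := hG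
  unfold Gate.depthAgainst
  have h1 : ∀ l : List (Operand k τ), prodWeight (Gate.prod l) = 1 := fun l => rfl
  rw [h1, h1]
  refine Nat.add_le_add_left (foldr_max_le fun x hx => ?_) 1
  simp only [Gate.args, List.map_ofFn, List.mem_ofFn, Function.comp_apply] at hx
  obtain ⟨l, rfl⟩ := hx
  refine (depthIn_cop w n d out₀ D₀ ds hdp (us.get l) (f l)
    ((le_of_mem_antidiagonalTuple hf l).trans he)).trans ?_
  exact le_foldr_max_of_mem (List.mem_map.mpr ⟨us.get l, List.get_mem us l, rfl⟩)

/-- Depth entry of the collecting sum gate. -/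
theorem depthAgainst_prodS_le (D Pd : List ℕ) {e δ L : ℕ} (hL : L = D.length)
    (_hlen : Pd.length = (prodP w n out₀ us e).length) (hPd : ∀ x ∈ Pd, x ≤ δ) :
    Gate.depthAgainst prodWeight (D ++ Pd) (prodS w n out₀ us L e) ≤ δ := by
  subst hL
  unfold Gate.depthAgainst
  have h0 : ∀ l : List (k × Operand k τ), prodWeight (Gate.sum l) = 0 := fun l => rfl
  rw [prodS, h0, zero_add]
  refine foldr_max_le fun x hx => ?_
  simp only [Gate.args, List.map_map, List.mem_map, List.mem_range, Function.comp_apply] at hx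
  obtain ⟨idx, _, rfl⟩ := hx
  simp only [Operand.depthIn, getD_append_length_add]
  exact getD_le_of_forall_le hPd idx
end ProdStep

end Summit.ValiantsHypothesis.ValiantsHypothesis.Theorems.DepthWindow
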